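import Literature.AnabelianGeometry.SemiGraphs.PSCSeparatingCoveringsSameVertex
import Literature.GroupTheory.CombinatorialGroupTheory.FreeBasisCutoffCharacterTwist
import HarnessLib

/-!
# [CombGC] Prop. 1.2, proof p. 9: verticial separating coverings for vertex groups that are NOT free factors

Mochizuki, *A combinatorial version of the Grothendieck conjecture*, Tohoku Math. J. **59** (2007)
[CombGC], PROOF of Proposition 1.2, author's manuscript p. 9: "if `v₁ ≠ v₂` …, then there exists a
finite étale … covering `G' → G` whose restriction to the anabelioid `G_{v₂}` is trivial …, but whose
restriction to the anabelioid `G_{v₁}` is nontrivial … by gluing together appropriate finite étale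
coverings of the anabelioids `G_v`, `G_e`" [cite: MochizukiCombGC2007, Prop 1.2 proof p.9]; typed
LEVEL-WISE by abc-iut-w4-d081 as `PSCDatum.VerticialSeparatingCoverings` (`PSCSeparatingCoverings.lean`,
row P12-L01-V; verticial conjunct of FACT-LIST rows F-2829 / F-2830, instance form F-2826).

PROOF-ONLY file (abc-iut-f-164 gen 5).  The free-factor engines of abc-iut-f-166
(`PSCSeparatingCoveringsSameVertex.lean`: fibred twist; `PSCSeparatingCoveringsCrossVertex.lean`:
projection) cover vertex groups `Π_v = cl ι⟨b(S)⟩` that are closures of FREE FACTORS of the discrete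
`π₁`.  A component of a pointed stable curve carrying ALL the marked points of a two-component curve is
not of that shape: `Π_{v₀} = cl ι⟨a_i, b_i (i < g₀), c_0, …, c_r⟩ = cl ι⟨b(S) ∪ {ε}⟩` with
`ε = (∏_{i ≥ g₀}[a_i, b_i])⁻¹` the boundary of the complementary handles — a word in the letters OUTSIDE
`S`.  This file supplies the two clauses of row P12-L01-V for vertex groups of the general shape
`cl ι⟨b(S) ∪ E⟩`, `E` a set of words in letters killed by a global character:

* `IsProSigmaCompletion.cutoff_exists_open_separating_sameVertex` — two DISTINCT level-`V` vertices over
  the SAME vertex, by the CUT-OFF CHARACTER TWIST of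
  `Literature/GroupTheory/CombinatorialGroupTheory/FreeBasisCutoffCharacterTwist.lean` at the discrete
  level `K = ι⁻¹(V)` (a character `Ψ : Γ → ℤ` killing the letters outside `S`, nonzero on a letter of
  `S`, reduced modulo a large power of `ℓ ∈ Σ`), transferred along the pro-`Σ` completion `V` of `K`
  exactly as in f-166's file;
* `IsProSigmaCompletion.exists_open_separating_of_character` — level vertices over two DIFFERENT vertex
  groups `A₁`, `A₂` whenever some character `Ψ : Γ → ℤ` kills a dense subgroup of `A₂` and is nonzero on
  some `ι(a) ∈ A₁`: the continuous extension to `Π` of `Ψ mod ℓⁿ` (`exists_continuous_extend_top`) kills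
  every conjugate of `A₂` and not `γ₁ ι(a)^{[Π:V]} γ₁⁻¹ ∈ γ₁A₁γ₁⁻¹ ∩ V` (abelian projection; no
  injectivity of `ι` needed);
* `PSCDatum.verticialSeparatingCoverings_of_sameVertex_of_crossVertex` — row P12-L01-V (`V' := V`) from
  the two clauses, vertex by vertex.

Instance-level tools at data of the shape of genuine curves; not the printed statement for all pointed
stable curves (cell FOUNDATIONS rows 13–14).  0 definitions; nothing here takes a side on [IUTchIII]
Cor. 3.12.
-/

noncomputable section

namespace Literature.AnabelianGeometry.SemiGraphs

open scoped Pointwise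
open Literature.AnabelianGeometry.Anabelioids (IsSigmaInteger)
open Literature.GroupTheory.CombinatorialGroupTheory
open Literature.GroupTheory.CombinatorialGroupTheory.FreeBasisCutoffCharacterTwist
  (exists_normal_separating_of_cutoff)

universe u

/-! ### Bookkeeping: conjugates inside a normal open level -/

section Bookkeeping

variable {P : Type*} [Group P]

/-- `f (a H a⁻¹) = f(a) f(H) f(a)⁻¹`. [folklore] -/
private theorem map_toConjAct_smul'' {Γ : Type*} [Group Γ] (f : Γ →* P) (a : Γ) (H : Subgroup Γ) :
    (ConjAct.toConjAct a • H).map f = ConjAct.toConjAct (f a) • H.map f := by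
  rw [← map_conj_eq_conjAct_smul, ← map_conj_eq_conjAct_smul, Subgroup.map_map, Subgroup.map_map]
  congr 1
  ext x
  simp [MulAut.conj_apply]

/-- The image in `Π` of a subgroup `U'` normal in `V` is stable under conjugation by `V`. [folklore] -/
private theorem conjAct_smul_map_subtype_of_mem'' {V : Subgroup P} (U' : Subgroup V) [hU : U'.Normal]
    {t : P} (ht : t ∈ V) : ConjAct.toConjAct t • U'.map V.subtype = U'.map V.subtype := by
  ext x
  rw [Subgroup.mem_pointwise_smul_iff_inv_smul_mem, ← map_inv, ConjAct.smul_def,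
    ConjAct.ofConjAct_toConjAct, inv_inv]
  constructor
  · intro hx
    obtain ⟨u, hu, hux⟩ := Subgroup.mem_map.mp hx
    refine Subgroup.mem_map.mpr ⟨⟨t, ht⟩ * u * ⟨t, ht⟩⁻¹, hU.conj_mem u hu ⟨t, ht⟩, ?_⟩
    have hux' : (u : P) = t⁻¹ * x * t := hux
    change ((⟨t, ht⟩ * u * ⟨t, ht⟩⁻¹ : V) : P) = x
    rw [Subgroup.coe_mul, Subgroup.coe_mul, Subgroup.coe_inv, hux']
    group
  · intro hx
    obtain ⟨u, hu, rfl⟩ := Subgroup.mem_map.mp hx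
    refine Subgroup.mem_map.mpr ⟨⟨t, ht⟩⁻¹ * u * ⟨t, ht⟩⁻¹⁻¹, hU.conj_mem u hu ⟨t, ht⟩⁻¹, ?_⟩
    change ((⟨t, ht⟩⁻¹ * u * ⟨t, ht⟩⁻¹⁻¹ : V) : P) = t⁻¹ * (u : P) * t
    rw [inv_inv, Subgroup.coe_mul, Subgroup.coe_mul, Subgroup.coe_inv]

/-- For `U'` normal in `V` and `t ∈ V`: `t B t⁻¹ ⊆ U'` iff `B ⊆ U'`. [cite: MochizukiCombGC2007, Def 1.1(ii) p.6] -/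
private theorem conjAct_smul_le_iff'' {V : Subgroup P} (U' : Subgroup V) [U'.Normal] {t : P} (ht : t ∈ V)
    (B : Subgroup P) : ConjAct.toConjAct t • B ≤ U'.map V.subtype ↔ B ≤ U'.map V.subtype := by
  conv_lhs => rw [← conjAct_smul_map_subtype_of_mem'' U' ht]
  exact Subgroup.pointwise_smul_le_pointwise_smul_iff

/-- A prime power `ℓᵏ` with `ℓ ∈ Σ` is a `Σ`-integer. [cite: MochizukiSemiAnbd2006, Ex. 2.10 p.31] -/
theorem isSigmaInteger_prime_pow {Sigma : Set ℕ} {ℓ : ℕ} (hℓ : ℓ.Prime) (hℓS : ℓ ∈ Sigma) (k : ℕ) :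
    IsSigmaInteger Sigma (ℓ ^ k) :=
  ⟨pow_pos hℓ.pos k, fun _ hp hdvd => by
    rw [(Nat.prime_dvd_prime_iff_eq hp hℓ).mp (hp.dvd_of_dvd_pow hdvd)]
    exact hℓS⟩

/-- Reduction of a nonzero integer modulo a large power of a prime is nonzero: `t mod ℓ^{|t|} ≠ 0`.
[folklore] -/
private theorem intCast_zmod_pow_natAbs_ne_zero {ℓ : ℕ} (hℓ : ℓ.Prime) {t : ℤ} (ht : t ≠ 0) :
    ((t : ℤ) : ZMod (ℓ ^ t.natAbs)) ≠ 0 := by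
  haveI : NeZero (ℓ ^ t.natAbs) := ⟨pow_ne_zero _ hℓ.ne_zero⟩
  intro h
  rw [ZMod.intCast_zmod_eq_zero_iff_dvd] at h
  refine ht (Int.eq_zero_of_dvd_of_natAbs_lt_natAbs h ?_)
  rw [Int.natAbs_natCast]
  exact Nat.lt_pow_self hℓ.one_lt

end Bookkeeping

/-! ### The same-vertex separating covering, cut-off form -/

namespace SemiGraphOfAnabelioids.IsProSigmaCompletion

variable {Sigma : Set ℕ} {Γ : Type*} [Group Γ] {P : Type*} [Group P] [TopologicalSpace P]
  [IsTopologicalGroup P] [CompactSpace P] [TotallyDisconnectedSpace P] {ι : Γ →* P}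

/-- **[CombGC] Prop. 1.2, proof p. 9 — the verticial separating covering at ONE vertex, cut-off form.**
Let `ι : Γ → Π` be a pro-`Σ` completion (`Π` profinite) of a free group `Γ` with basis `b`, `S ⊆ β`,
`Ψ : Γ → ℤ` a character killing the letters outside `S` and nonzero on the letter `b_{i₀}`, `i₀ ∈ S`,
`E` a set of words in letters killed by `Ψ`, `A = cl ι⟨b(S) ∪ E⟩` (e.g. `Π_{v₀} = cl ι⟨a_i, b_i (i<g₀),
c_j, ε⟩` of a component carrying all the cusps), `ℓ ∈ Σ` prime, `V ⊴ Π` open.  For `γ₁, γ₂ ∈ Π` with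
`Vγ₁A ≠ Vγ₂A` there is an open `U ≤ V`, normal in `V`, with `γ₂Aγ₂⁻¹ ∩ V ≤ U` and `γ₁Aγ₁⁻¹ ∩ V ⊄ U`.
PROOF: `K = ι⁻¹(V)`; `γᵢ = wᵢ·ι(fᵢ)`, `wᵢ ∈ V`; distinct double cosets force `f₁⁻¹f₂ ∉ A_Γ K`; the cut-off
character twist gives `U' ⊴ K` of `ℓ`-power index with `f₁(A_Γ ∩ K)f₁⁻¹ ⊄ U' ⊇ f₂(A_Γ ∩ K)f₂⁻¹`; `V` is
the pro-`Σ` completion of `K`, so `U'` is the trace of an open `U ⊴ V`.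
[cite: MochizukiCombGC2007, Prop 1.2 proof p.9] -/
theorem cutoff_exists_open_separating_sameVertex (hι : IsProSigmaCompletion Sigma ι)
    {β : Type*} (b : FreeGroupBasis β Γ) (S : Set β)
    (Ψ : Γ →* Multiplicative ℤ) (hΨ : ∀ i, i ∉ S → Ψ (b i) = 1)
    (E : Set Γ) (hE : E ⊆ Subgroup.closure (b '' {i | i ∈ S → Ψ (b i) = 1}))
    (AS : Subgroup Γ) (hAS : AS = Subgroup.closure (b '' S ∪ E))
    {i₀ : β} (hi₀ : i₀ ∈ S) (hΨi₀ : Ψ (b i₀) ≠ 1)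
    {ℓ : ℕ} (hℓ : ℓ.Prime) (hℓS : ℓ ∈ Sigma)
    (A : Subgroup P) (hA : A = (AS.map ι).topologicalClosure)
    (V : Subgroup P) [hVn : V.Normal] (hVo : IsOpen (V : Set P)) (γ₁ γ₂ : ConjAct P)
    (hne : DoubleCoset.doubleCoset (ConjAct.ofConjAct γ₁) (V : Set P) (A : Set P) ≠
      DoubleCoset.doubleCoset (ConjAct.ofConjAct γ₂) (V : Set P) (A : Set P)) :
    ∃ U : Subgroup P, IsOpen (U : Set P) ∧ U ≤ V ∧ (U.subgroupOf V).Normal ∧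
      (γ₂ • A) ⊓ V ≤ U ∧ ¬ ((γ₁ • A) ⊓ V ≤ U) := by
  classical
  -- (A) the discrete level `K = ι⁻¹(V)`, a normal subgroup of finite index of the free group `Γ`
  obtain ⟨K, hK⟩ : ∃ K : Subgroup Γ, K = V.comap ι := ⟨_, rfl⟩
  haveI hKn : K.Normal := by rw [hK]; infer_instance
  haveI : K.FiniteIndex := by rw [hK]; exact finiteIndex_comap hι V hVo
  -- (B) representatives of the two level vertices in `ι(Γ)`, up to `V`
  have stepB : ∀ γ : ConjAct P, ∃ (f : Γ) (w : P), w ∈ V ∧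
      (γ • A) ⊓ V = ConjAct.toConjAct w • ((ConjAct.toConjAct (ι f) • A) ⊓ V) ∧
      DoubleCoset.doubleCoset (ConjAct.ofConjAct γ) (V : Set P) (A : Set P) =
        DoubleCoset.doubleCoset (ι f) (V : Set P) (A : Set P) := by
    intro γ
    obtain ⟨f, hf⟩ := exists_mem_coset hι V hVo (ConjAct.ofConjAct γ)
    have hw : ConjAct.ofConjAct γ * (ι f)⁻¹ ∈ V := by
      have h1 := hVn.conj_mem _ (V.inv_mem hf) (ConjAct.ofConjAct γ)
      simpa [mul_assoc] using h1
    refine ⟨f, ConjAct.ofConjAct γ * (ι f)⁻¹, hw, ?_, ?_⟩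
    · rw [Subgroup.smul_inf, conjAct_smul_eq_self_of_mem hw, ← mul_smul, ← map_mul,
        inv_mul_cancel_right, ConjAct.toConjAct_ofConjAct]
    · exact DoubleCoset.doubleCoset_eq_of_mem (DoubleCoset.mem_doubleCoset.mpr
        ⟨ConjAct.ofConjAct γ * (ι f)⁻¹, hw, 1, A.one_mem, by group⟩)
  obtain ⟨f₁, w₁, hw₁, hA₁, hdc₁⟩ := stepB γ₁
  obtain ⟨f₂, w₂, hw₂, hA₂, hdc₂⟩ := stepB γ₂
  -- the level vertex of `f` seen in `Π`: `ι(f) A ι(f)⁻¹ ∩ V = cl ι(f (A_Γ ∩ K) f⁻¹)`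
  have hlevel : ∀ f : Γ, (ConjAct.toConjAct (ι f) • A) ⊓ V =
      ((ConjAct.toConjAct f • (AS ⊓ K)).map ι).topologicalClosure := by
    intro f
    rw [hA, ← topologicalClosure_conjAct_smul, ← map_toConjAct_smul'', topologicalClosure_map_inf_of_isOpen
      ι _ V hVo, Subgroup.smul_inf, hKn.conjAct, hK]
  -- (C) distinct level vertices: `f₁⁻¹ f₂ ∉ A_Γ · K`
  have hδ : f₁⁻¹ * f₂ ∉ (AS : Set Γ) * (K : Set Γ) := by
    intro hmem
    obtain ⟨a, ha, k, hk, hak⟩ := Set.mem_mul.mp hmem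
    apply hne
    rw [hdc₁, hdc₂]
    symm
    have hkV : ι k ∈ V := by rw [hK] at hk; exact hk
    have haA : ι a ∈ A := by
      rw [hA]
      exact Subgroup.le_topologicalClosure _ (Subgroup.mem_map_of_mem ι ha)
    refine DoubleCoset.doubleCoset_eq_of_mem (DoubleCoset.mem_doubleCoset.mpr
      ⟨ι f₁ * ι a * ι k * (ι f₁ * ι a)⁻¹, hVn.conj_mem _ hkV (ι f₁ * ι a), ι a, haA, ?_⟩)
    have hf₂ : f₂ = f₁ * (a * k) := by rw [hak, mul_inv_cancel_left]
    rw [hf₂, map_mul, map_mul]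
    group
  -- (D) the cut-off character twist at the discrete level
  obtain ⟨U', hU'n, ⟨k, hU'idx⟩, hU'not, hU'le⟩ :=
    exists_normal_separating_of_cutoff b S Ψ hΨ E hE AS hAS hi₀ hΨi₀ K hℓ f₁
  -- (E) `V` is the pro-`Σ` completion of `K`: `U'` is the trace of an open `U₀ ⊴ V`
  subst hK
  haveI := hU'n
  have hU'S : IsSigmaInteger Sigma U'.index := by
    rw [hU'idx]
    exact isSigmaInteger_prime_pow hℓ hℓS k
  have hι' : IsProSigmaCompletion Sigma (ι.subgroupComap V) := restrict hι V hVo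
  obtain ⟨U₀, hU₀o, hU₀c⟩ := exists_isOpen_comap_subgroupComap_eq hι V hVo U' hU'S
  haveI hU₀n : U₀.Normal := normal_of_comap_normal hι' U₀ hU₀o (by rw [hU₀c]; exact hU'n)
  have hUo : IsOpen ((U₀.map V.subtype : Subgroup P) : Set P) := isOpen_map_subtype V hVo U₀ hU₀o
  -- dictionary between `U'.map K.subtype ≤ Γ` and `U₀.map V.subtype ≤ Π`
  have hdict : ∀ {z : Γ} (hz : z ∈ V.comap ι), ι z ∈ U₀.map V.subtype ↔ z ∈ U'.map (V.comap ι).subtype := by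
    intro z hz
    constructor
    · intro h
      obtain ⟨u, hu, huz⟩ := Subgroup.mem_map.mp h
      have hu' : u = ι.subgroupComap V ⟨z, hz⟩ := Subtype.ext huz
      rw [hu', ← Subgroup.mem_comap, hU₀c] at hu
      exact Subgroup.mem_map.mpr ⟨⟨z, hz⟩, hu, rfl⟩
    · intro h
      obtain ⟨u, hu, huz⟩ := Subgroup.mem_map.mp h
      rw [← hU₀c, Subgroup.mem_comap] at hu
      have huz' : (u : Γ) = z := huz
      refine Subgroup.mem_map.mpr ⟨ι.subgroupComap V u, hu, ?_⟩
      change ι (u : Γ) = ι z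
      rw [huz']
  refine ⟨U₀.map V.subtype, hUo, Subgroup.map_subtype_le U₀, ?_, ?_, ?_⟩
  · rw [← Subgroup.comap_subtype, Subgroup.comap_map_eq_self_of_injective V.subtype_injective]
    exact hU₀n
  · -- trivial over the vertex of `f₂`
    rw [hA₂, conjAct_smul_le_iff'' U₀ hw₂, hlevel f₂]
    refine Subgroup.topologicalClosure_minimal _ ?_ (Subgroup.isClosed_of_isOpen _ hUo)
    rintro _ ⟨z, hz, rfl⟩
    have hzU : z ∈ U'.map (V.comap ι).subtype := hU'le f₂ hδ hz
    obtain ⟨u, -, huz⟩ := Subgroup.mem_map.mp hzU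
    have hzK : z ∈ V.comap ι := by rw [← huz]; exact u.2
    exact (hdict hzK).mpr hzU
  · -- nontrivial over the vertex of `f₁`
    rw [hA₁, conjAct_smul_le_iff'' U₀ hw₁, hlevel f₁]
    intro hle
    apply hU'not
    intro z hz
    have hzK : z ∈ V.comap ι := by
      obtain ⟨x, hx, rfl⟩ := (Subgroup.mem_smul_pointwise_iff_exists _ _ _).mp hz
      rw [ConjAct.smul_def, ConjAct.ofConjAct_toConjAct]
      exact (inferInstance : (V.comap ι).Normal).conj_mem x hx.2 f₁
    have h1 : ι z ∈ U₀.map V.subtype :=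
      hle (Subgroup.le_topologicalClosure _ (Subgroup.mem_map_of_mem ι hz))
    exact (hdict hzK).mp h1

/-! ### Level vertices over two different vertices: separation by an abelian character -/

/-- **[CombGC] Prop. 1.2, proof p. 9 — the verticial separating covering over two DISTINCT vertices,
abelian form.**  `ι : Γ → Π` a pro-`Σ` completion (`Π` profinite), `ℓ ∈ Σ` prime, `Ψ : Γ → ℤ` a
character killing a subgroup `H₂` with `A₂ = cl ι(H₂)`, `A₁ ≤ Π` containing some `ι(a)` with `Ψ(a) ≠ 0`,
`V ⊴ Π` open.  Then for ALL `γ₁, γ₂` there is an open `U ≤ V`, normal in `V`, with `γ₂A₂γ₂⁻¹ ∩ V ≤ U`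
and `γ₁A₁γ₁⁻¹ ∩ V ⊄ U`: the continuous extension `F : Π → ℤ/ℓⁿ` of `Ψ mod ℓⁿ`, `ℓⁿ > |[Π:V]·Ψ(a)|`, kills
`A₂` and every conjugate, while `F(γ₁ ι(a)^{[Π:V]} γ₁⁻¹) = [Π:V]·Ψ(a) ≠ 0`; `U := V ∩ Ker F`.
[cite: MochizukiCombGC2007, Prop 1.2 proof p.9] -/
theorem exists_open_separating_of_character (hι : IsProSigmaCompletion Sigma ι)
    {ℓ : ℕ} (hℓ : ℓ.Prime) (hℓS : ℓ ∈ Sigma) (Ψ : Γ →* Multiplicative ℤ)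
    (A₂ : Subgroup P) (H₂ : Subgroup Γ) (hA₂ : A₂ = (H₂.map ι).topologicalClosure)
    (hΨ₂ : ∀ x ∈ H₂, Ψ x = 1) (A₁ : Subgroup P) (a : Γ) (haA : ι a ∈ A₁) (hΨa : Ψ a ≠ 1)
    (V : Subgroup P) [hVn : V.Normal] (hVo : IsOpen (V : Set P)) (γ₁ γ₂ : ConjAct P) :
    ∃ U : Subgroup P, IsOpen (U : Set P) ∧ U ≤ V ∧ (U.subgroupOf V).Normal ∧
      (γ₂ • A₂) ⊓ V ≤ U ∧ ¬ ((γ₁ • A₁) ⊓ V ≤ U) := by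
  classical
  -- `V` has finite index `m`; `ι(a)^m ∈ V`
  have hVi : IsSigmaInteger Sigma V.index := hι.index_open V hVn hVo
  haveI : V.FiniteIndex := ⟨hVi.1.ne'⟩
  set m : ℕ := V.index with hm
  set y : Γ := a ^ m with hy
  have hyV : ι y ∈ V := by rw [hy, map_pow]; exact Subgroup.pow_index_mem V (ι a)
  have hyA : ι y ∈ A₁ := by rw [hy, map_pow]; exact A₁.pow_mem haA m
  -- `Ψ(y) = m · Ψ(a) ≠ 0`; reduce modulo `ℓⁿ`, `n = |m · Ψ(a)|`
  set t₀ : ℤ := Multiplicative.toAdd (Ψ a) with ht₀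
  have ht₀ne : t₀ ≠ 0 := fun h => hΨa (by rw [← ofAdd_toAdd (Ψ a), ← ht₀, h, ofAdd_zero])
  set t : ℤ := (m : ℤ) * t₀ with htdef
  have htne : t ≠ 0 := mul_ne_zero (Nat.cast_ne_zero.mpr hVi.1.ne') ht₀ne
  have hΨy : Multiplicative.toAdd (Ψ y) = t := by
    rw [hy, map_pow, toAdd_pow, ← ht₀, nsmul_eq_mul]
  set n : ℕ := t.natAbs with hn
  have htmod : ((t : ℤ) : ZMod (ℓ ^ n)) ≠ 0 := intCast_zmod_pow_natAbs_ne_zero hℓ htne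
  -- the finite `Σ`-quotient `ℤ/ℓⁿ` and the continuous extension `F` of `Ψ mod ℓⁿ`
  letI : TopologicalSpace (Multiplicative (ZMod (ℓ ^ n))) := ⊥
  haveI : DiscreteTopology (Multiplicative (ZMod (ℓ ^ n))) := ⟨rfl⟩
  haveI : NeZero (ℓ ^ n) := ⟨pow_ne_zero n hℓ.ne_zero⟩
  have hQ : IsSigmaInteger Sigma (Nat.card (Multiplicative (ZMod (ℓ ^ n)))) := by
    rw [show Nat.card (Multiplicative (ZMod (ℓ ^ n))) = ℓ ^ n from Nat.card_zmod (ℓ ^ n)]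
    exact isSigmaInteger_prime_pow hℓ hℓS n
  let Φ : Γ →* Multiplicative (ZMod (ℓ ^ n)) :=
    (AddMonoidHom.toMultiplicative (Int.castAddHom (ZMod (ℓ ^ n)))).comp Ψ
  have hΦapply : ∀ x, Φ x = Multiplicative.ofAdd ((Multiplicative.toAdd (Ψ x) : ℤ) : ZMod (ℓ ^ n)) :=
    fun x => rfl
  have hΦy : Φ y ≠ 1 := by
    rw [hΦapply, hΨy]
    intro h
    exact htmod (Multiplicative.ofAdd.injective (h.trans ofAdd_zero.symm))
  have hΦ₂ : ∀ x ∈ H₂, Φ x = 1 := fun x hx => by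
    rw [hΦapply, hΨ₂ x hx, toAdd_one, Int.cast_zero, ofAdd_zero]
  obtain ⟨F, hFc, hF⟩ := exists_continuous_extend_top hι hQ Φ
  -- `U := V ∩ Ker F`
  have hkero : IsOpen ((F.ker : Subgroup P) : Set P) := by
    have hker : ((F.ker : Subgroup P) : Set P) = F ⁻¹' {1} := by
      ext x
      simp only [SetLike.mem_coe, MonoidHom.mem_ker, Set.mem_preimage, Set.mem_singleton_iff]
    rw [hker]
    exact (isOpen_discrete _).preimage hFc
  have hA₂ker : A₂ ≤ F.ker := by
    rw [hA₂]
    refine Subgroup.topologicalClosure_minimal _ ?_ (Subgroup.isClosed_of_isOpen _ hkero)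
    rintro _ ⟨x, hx, rfl⟩
    rw [MonoidHom.mem_ker, hF x]
    exact hΦ₂ x hx
  refine ⟨V ⊓ F.ker, hVo.inter hkero, inf_le_left, ?_, ?_, ?_⟩
  · rw [Subgroup.inf_subgroupOf_left]
    infer_instance
  · refine le_inf inf_le_right (inf_le_left.trans ?_)
    rw [← (inferInstance : F.ker.Normal).conjAct γ₂]
    exact Subgroup.pointwise_smul_le_pointwise_smul_iff.mpr hA₂ker
  · intro hle
    apply hΦy
    have hz : ConjAct.ofConjAct γ₁ * ι y * (ConjAct.ofConjAct γ₁)⁻¹ ∈ (γ₁ • A₁) ⊓ V := by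
      refine Subgroup.mem_inf.mpr ⟨?_, hVn.conj_mem _ hyV _⟩
      have h := Subgroup.smul_mem_pointwise_smul (ι y) γ₁ A₁ hyA
      rwa [ConjAct.smul_def] at h
    have hker := (Subgroup.mem_inf.mp (hle hz)).2
    rw [MonoidHom.mem_ker, map_mul, map_mul, map_inv, mul_inv_cancel_comm, hF y] at hker
    exact hker

end SemiGraphOfAnabelioids.IsProSigmaCompletion

/-! ### Row P12-L01-V from the two clauses -/

namespace PSCDatum

variable {P : Type u} [Group P] [TopologicalSpace P]

/-- **Row P12-L01-V (`VerticialSeparatingCoverings`) from its two clauses at the level `V` itself**: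
if at every open normal level `V` two distinct level vertices over the SAME vertex of `G` can be
separated, and level vertices over DISTINCT vertices of `G` can be separated, then
`G.VerticialSeparatingCoverings` holds with `V' := V`. [cite: MochizukiCombGC2007, Prop 1.2 proof p.9] -/
theorem verticialSeparatingCoverings_of_sameVertex_of_crossVertex (G : PSCDatum P)
    (hsame : ∀ (V : Subgroup P), V.Normal → IsOpen (V : Set P) →
      ∀ (v : G.graph.V) (γ₁ γ₂ : ConjAct P),
        DoubleCoset.doubleCoset (ConjAct.ofConjAct γ₁) (V : Set P) (G.vertGp v : Set P) ≠
          DoubleCoset.doubleCoset (ConjAct.ofConjAct γ₂) (V : Set P) (G.vertGp v : Set P) →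
        ∃ U : Subgroup P, IsOpen (U : Set P) ∧ U ≤ V ∧ (U.subgroupOf V).Normal ∧
          (γ₂ • G.vertGp v) ⊓ V ≤ U ∧ ¬ ((γ₁ • G.vertGp v) ⊓ V ≤ U))
    (hcross : ∀ (V : Subgroup P), V.Normal → IsOpen (V : Set P) →
      ∀ (v₁ v₂ : G.graph.V) (γ₁ γ₂ : ConjAct P), v₁ ≠ v₂ →
        ∃ U : Subgroup P, IsOpen (U : Set P) ∧ U ≤ V ∧ (U.subgroupOf V).Normal ∧
          (γ₂ • G.vertGp v₂) ⊓ V ≤ U ∧ ¬ ((γ₁ • G.vertGp v₁) ⊓ V ≤ U)) :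
    G.VerticialSeparatingCoverings := by
  intro V hVn hVo
  refine ⟨V, hVn, hVo, le_rfl, fun v₁ v₂ γ₁ γ₂ hne12 => ?_⟩
  by_cases h : v₁ = v₂
  · subst h
    exact hsame V hVn hVo v₁ γ₁ γ₂ (hne12.resolve_left fun hn => hn rfl)
  · exact hcross V hVn hVo v₁ v₂ γ₁ γ₂ h

end PSCDatum

end Literature.AnabelianGeometry.SemiGraphs

end
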